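import Mathlib
import HarnessLib
import Literature.Probability.LatticeModels.TorusFourierDecayFromDifferences

/-!
# Route `KLProgramme` — engine support (crux K1 stmt-HubbardSuperconductivity-19938 / ENGINE child): the `ℓ²` route to `ℓ¹` bounds of
# lattice Fourier sums on the torus — Plancherel for character sums, Plancherel WITH DIFFERENCES (multiplication by `χ_v(x) − 1` is a
# forward difference of the symbol), and the weighted Cauchy–Schwarz step

Generic lattice Fourier analysis (could live under `Literature/Probability/LatticeModels`; kept Summits-side as engine support);
companion of `Literature/Probability/LatticeModels/TorusFourierDecayFromDifferences.lean` (pointwise decay of a character sum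
`g(x) = Σ_k χ_k(x) ĝ(k)` from `N` differences of the symbol, `N` large) for consumers who control only FEW differences of the symbol:
the `ℓ²` route.  Cell gate-hubbard-kl, seat p4 (HOME/prover-p4/FRAME-L22-NOTE.md §3): the multiplier/propagator symbols of the
Kohn–Luttinger engine on an admissible frame are uniformly controlled only up to SECOND differences per direction (the frame's `C²` size);
`Σ_x ‖g(x)‖ ≤ (Σ_x W(x)‖g(x)‖²)^{1/2} (Σ_x W(x)⁻¹)^{1/2}` with a weight `W` built from `‖χ_v(x) − 1‖^{2N_v}`, `N_v ≤ 2`, needs exactly that.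

* `charSum_eq_conj_torusFourier`, **`sum_norm_sq_charSum`** — Plancherel for character sums: `Σ_x ‖Σ_k χ_k(x) ĝ(k)‖² = L^d Σ_k ‖ĝ(k)‖²`;
* `charSum_fwdDiff_iter`, `charSum_foldr_fwdDiff` — `Σ_k χ_k(x) (Δ_{v₁}^{N₁}⋯Δ_{v_r}^{N_r} ĝ)(k) = Π_i (conj χ_{v_i}(x) − 1)^{N_i} · g(x)`;
* **`sum_prod_norm_sub_one_pow_mul_norm_sq_charSum`** — Plancherel with differences:
  `Σ_x Π_i ‖χ_{v_i}(x) − 1‖^{2N_i} ‖g(x)‖² = L^d Σ_k ‖(Δ_{v₁}^{N₁}⋯Δ_{v_r}^{N_r} ĝ)(k)‖²`, and its linear extension to weights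
  `W(x) = Σ_t c_t Π_{(v,N) ∈ t} ‖χ_v(x) − 1‖^{2N}` (**`sum_weight_mul_norm_sq_charSum`**) — e.g. the product weight
  `Π_v (1 + c_v‖χ_v(x) − 1‖⁴)` expanded into `2^r` terms uses second differences only;
* **`sum_norm_le_sqrt_mul_sqrt_of_weight`** — `Σ_x ‖g(x)‖ ≤ √(Σ_x W(x)‖g(x)‖²) · √(Σ_x W(x)⁻¹)` for `W > 0`;
* `prod_chord_pow_le_weight` — the chord bound from below (`le_norm_torusChar_sub_one`: `4|ã_v(x)|/L ≤ ‖χ_v(x) − 1‖`) turns such a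
  weight into the polynomial decay weight `Σ_t c_t Π (4|ã_v(x)|/L)^{2N}` whose inverse is summed by `AnisotropicTorusSum`-type lemmas.

Everything is proved; no definitions, no named facts. [folklore]

## Sources

S. Friedli, Y. Velenik, *Statistical Mechanics of Lattice Systems* (2017), §10.4 (discrete Fourier analysis on the torus)
(`FriedliVelenik2017`); G. Benfatto, A. Giuliani, V. Mastropietro, Ann. Henri Poincaré 7 (2006) 809–898, Lemma 2.2 and footnote ¹
(`BenfattoGiulianiMastropietro2006`).  Routine ("folklore").
-/

noncomputable section

open Finset Complex
open scoped Real ComplexConjugate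

namespace Summit.HubbardSuperconductivity.HubbardSuperconductivity.Theorems.TorusFourierL2

set_option linter.dupNamespace false -- summit = problem name (single-conjunct summit), D-0017

open Literature.Probability.LatticeModels

variable {d L : ℕ} [NeZero L]

/-! ### Plancherel for character sums -/

/-- The character sum of a symbol is the conjugate of the (unnormalised) torus Fourier transform of the conjugate symbol:
`Σ_k χ_k(x) ĝ(k) = conj (𝓕(conj ∘ ĝ)(x))`. [folklore] -/
theorem charSum_eq_conj_torusFourier (ĝ : TorusSite d L → ℂ) (x : TorusSite d L) :
    ∑ k, torusChar k x * ĝ k = conj (torusFourier (fun k => conj (ĝ k)) x) := by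
  rw [torusFourier_eq_sum_torusChar, map_sum]
  refine Finset.sum_congr rfl fun k _ => ?_
  rw [map_mul, Complex.conj_conj, Complex.conj_conj, torusChar_comm, mul_comm]

/-- **Plancherel for character sums**: `Σ_x ‖Σ_k χ_k(x) ĝ(k)‖² = L^d · Σ_k ‖ĝ(k)‖²`. [cite: FriedliVelenik2017, §10.4] -/
theorem sum_norm_sq_charSum (ĝ : TorusSite d L → ℂ) :
    ∑ x, ‖∑ k, torusChar k x * ĝ k‖ ^ 2 = (L : ℝ) ^ d * ∑ k, ‖ĝ k‖ ^ 2 := by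
  have h := torusFourier_plancherel_holds (d := d) (L := L) (fun k => conj (ĝ k))
  simp_rw [charSum_eq_conj_torusFourier, Complex.norm_conj]
  rw [h]
  simp

/-! ### Differences of the symbol ↔ multiplication by `χ_v − 1` -/

/-- **Iterated differences in one direction**: `Σ_k χ_k(x) (Δ_v^N ĝ)(k) = (conj χ_v(x) − 1)^N · Σ_k χ_k(x) ĝ(k)`. [folklore] -/
theorem charSum_fwdDiff_iter (v x : TorusSite d L) (N : ℕ) (ĝ : TorusSite d L → ℂ) :
    ∑ k, torusChar k x * ((fwdDiff v)^[N] ĝ) k = (conj (torusChar v x) - 1) ^ N * ∑ k, torusChar k x * ĝ k := by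
  have h := sum_torusChar_smul_fwdDiff_iter (E := ℂ) v x N ĝ
  simpa only [smul_eq_mul] using h

/-- **Mixed iterated differences**: for a list `l` of (direction, order) pairs,
`Σ_k χ_k(x) (Δ_{v₁}^{N₁}(⋯(Δ_{v_r}^{N_r} ĝ)))(k) = (Π_i (conj χ_{v_i}(x) − 1)^{N_i}) · Σ_k χ_k(x) ĝ(k)`. [folklore] -/
theorem charSum_foldr_fwdDiff (x : TorusSite d L) :
    ∀ (l : List (TorusSite d L × ℕ)) (ĝ : TorusSite d L → ℂ),
      ∑ k, torusChar k x * (l.foldr (fun p g => (fwdDiff p.1)^[p.2] g) ĝ) k =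
        (l.map fun p => (conj (torusChar p.1 x) - 1) ^ p.2).prod * ∑ k, torusChar k x * ĝ k
  | [], ĝ => by simp
  | p :: l, ĝ => by
    rw [List.foldr_cons, charSum_fwdDiff_iter, charSum_foldr_fwdDiff x l ĝ, List.map_cons, List.prod_cons]
    ring

/-- `‖conj χ_v(x) − 1‖ = ‖χ_v(x) − 1‖`. [folklore] -/
theorem norm_conj_torusChar_sub_one (v x : TorusSite d L) : ‖conj (torusChar v x) - 1‖ = ‖torusChar v x - 1‖ := by
  rw [← Complex.norm_conj, map_sub, Complex.conj_conj, map_one]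

/-- The norm of the product of character factors. [folklore] -/
theorem norm_prod_conj_torusChar_sub_one_pow (x : TorusSite d L) (l : List (TorusSite d L × ℕ)) :
    ‖(l.map fun p => (conj (torusChar p.1 x) - 1) ^ p.2).prod‖ = (l.map fun p => ‖torusChar p.1 x - 1‖ ^ p.2).prod := by
  induction l with
  | nil => simp
  | cons p l ih => rw [List.map_cons, List.prod_cons, norm_mul, ih, norm_pow, norm_conj_torusChar_sub_one, List.map_cons, List.prod_cons]

/-- **Plancherel with differences**: `Σ_x (Π_i ‖χ_{v_i}(x) − 1‖^{N_i})² ‖g(x)‖² = L^d Σ_k ‖(Δ_{v₁}^{N₁}⋯Δ_{v_r}^{N_r} ĝ)(k)‖²`.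
[cite: FriedliVelenik2017, §10.4] -/
theorem sum_prod_norm_sub_one_pow_mul_norm_sq_charSum (l : List (TorusSite d L × ℕ)) (ĝ : TorusSite d L → ℂ) :
    ∑ x, (l.map fun p => ‖torusChar p.1 x - 1‖ ^ p.2).prod ^ 2 * ‖∑ k, torusChar k x * ĝ k‖ ^ 2 =
      (L : ℝ) ^ d * ∑ k, ‖(l.foldr (fun p g => (fwdDiff p.1)^[p.2] g) ĝ) k‖ ^ 2 := by
  rw [← sum_norm_sq_charSum]
  refine Finset.sum_congr rfl fun x _ => ?_
  rw [charSum_foldr_fwdDiff, norm_mul, norm_prod_conj_torusChar_sub_one_pow, mul_pow]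

/-- **Linear weights**: for a finite family of terms `t ∈ T`, each a list of (direction, order) pairs with a coefficient `c t`,
`Σ_x (Σ_t c_t (Π_{(v,N) ∈ t} ‖χ_v(x) − 1‖^{N})²) ‖g(x)‖² = L^d Σ_t c_t Σ_k ‖(Δ_t ĝ)(k)‖²` — e.g. the product weight
`Π_v (1 + c_v ‖χ_v(x) − 1‖⁴)` expanded over subsets, which uses SECOND differences only. [folklore] -/
theorem sum_weight_mul_norm_sq_charSum {ι : Type*} (T : Finset ι) (term : ι → List (TorusSite d L × ℕ)) (c : ι → ℝ)
    (ĝ : TorusSite d L → ℂ) :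
    ∑ x, (∑ t ∈ T, c t * ((term t).map fun p => ‖torusChar p.1 x - 1‖ ^ p.2).prod ^ 2) * ‖∑ k, torusChar k x * ĝ k‖ ^ 2 =
      (L : ℝ) ^ d * ∑ t ∈ T, c t * ∑ k, ‖((term t).foldr (fun p g => (fwdDiff p.1)^[p.2] g) ĝ) k‖ ^ 2 := by
  simp_rw [Finset.sum_mul, mul_assoc]
  rw [Finset.sum_comm, Finset.mul_sum]
  refine Finset.sum_congr rfl fun t _ => ?_
  rw [← Finset.mul_sum, sum_prod_norm_sub_one_pow_mul_norm_sq_charSum, ← mul_assoc, mul_comm (c t), mul_assoc]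

/-! ### The weighted Cauchy–Schwarz step -/

/-- **`ℓ¹` from weighted `ℓ²`**: for a positive weight `W`, `Σ_x ‖g(x)‖ ≤ √(Σ_x W(x) ‖g(x)‖²) · √(Σ_x W(x)⁻¹)`. [folklore] -/
theorem sum_norm_le_sqrt_mul_sqrt_of_weight {α : Type*} (s : Finset α) (W : α → ℝ) (hW : ∀ x ∈ s, 0 < W x) (g : α → ℂ) :
    ∑ x ∈ s, ‖g x‖ ≤ Real.sqrt (∑ x ∈ s, W x * ‖g x‖ ^ 2) * Real.sqrt (∑ x ∈ s, (W x)⁻¹) := by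
  have h := Real.sum_mul_le_sqrt_mul_sqrt s (fun x => Real.sqrt (W x) * ‖g x‖) (fun x => (Real.sqrt (W x))⁻¹)
  have h1 : ∀ x ∈ s, Real.sqrt (W x) * ‖g x‖ * (Real.sqrt (W x))⁻¹ = ‖g x‖ := fun x hx => by
    have hs : Real.sqrt (W x) ≠ 0 := (Real.sqrt_pos.2 (hW x hx)).ne'
    field_simp
  have h2 : ∀ x ∈ s, (Real.sqrt (W x) * ‖g x‖) ^ 2 = W x * ‖g x‖ ^ 2 := fun x hx => by
    rw [mul_pow, Real.sq_sqrt (hW x hx).le]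
  have h3 : ∀ x ∈ s, ((Real.sqrt (W x))⁻¹) ^ 2 = (W x)⁻¹ := fun x hx => by
    rw [inv_pow, Real.sq_sqrt (hW x hx).le]
  rw [Finset.sum_congr rfl h1, Finset.sum_congr rfl h2, Finset.sum_congr rfl h3] at h
  exact h

/-- **The `ℓ¹` norm of a character sum from weighted second (or any) differences of its symbol**: with the weight
`W(x) = Σ_t c_t (Π_{(v,N)∈t} ‖χ_v(x) − 1‖^N)²` positive,
`Σ_x ‖g(x)‖ ≤ √(L^d Σ_t c_t Σ_k ‖Δ_t ĝ(k)‖²) · √(Σ_x W(x)⁻¹)`. [cite: BenfattoGiulianiMastropietro2006, Lemma 2.2 and footnote 1] -/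
theorem sum_norm_charSum_le_of_differences {ι : Type*} (T : Finset ι) (term : ι → List (TorusSite d L × ℕ)) (c : ι → ℝ)
    (ĝ : TorusSite d L → ℂ)
    (hW : ∀ x : TorusSite d L, 0 < ∑ t ∈ T, c t * ((term t).map fun p => ‖torusChar p.1 x - 1‖ ^ p.2).prod ^ 2) :
    ∑ x, ‖∑ k, torusChar k x * ĝ k‖ ≤
      Real.sqrt ((L : ℝ) ^ d * ∑ t ∈ T, c t * ∑ k, ‖((term t).foldr (fun p g => (fwdDiff p.1)^[p.2] g) ĝ) k‖ ^ 2) *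
        Real.sqrt (∑ x, (∑ t ∈ T, c t * ((term t).map fun p => ‖torusChar p.1 x - 1‖ ^ p.2).prod ^ 2)⁻¹) := by
  have h := sum_norm_le_sqrt_mul_sqrt_of_weight Finset.univ
    (fun x => ∑ t ∈ T, c t * ((term t).map fun p => ‖torusChar p.1 x - 1‖ ^ p.2).prod ^ 2) (fun x _ => hW x)
    (fun x => ∑ k, torusChar k x * ĝ k)
  rwa [sum_weight_mul_norm_sq_charSum] at h

/-! ### The chord bound turns character weights into polynomial decay weights -/

/-- **Chord bound for the product factors**: `Π (4|ã_{v}(x)|/L)^{N} ≤ Π ‖χ_v(x) − 1‖^{N}`. [folklore] -/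
theorem prod_chord_pow_le (x : TorusSite d L) (l : List (TorusSite d L × ℕ)) :
    (l.map fun p => (4 * |((∑ j, p.1 j * x j).valMinAbs : ℝ)| / L) ^ p.2).prod ≤ (l.map fun p => ‖torusChar p.1 x - 1‖ ^ p.2).prod := by
  induction l with
  | nil => simp
  | cons p l ih =>
    rw [List.map_cons, List.prod_cons, List.map_cons, List.prod_cons]
    have h0 : 0 ≤ (4 * |((∑ j, p.1 j * x j).valMinAbs : ℝ)| / L) ^ p.2 := by positivity
    have h1 : (4 * |((∑ j, p.1 j * x j).valMinAbs : ℝ)| / L) ^ p.2 ≤ ‖torusChar p.1 x - 1‖ ^ p.2 :=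
      pow_le_pow_left₀ (by positivity) (le_norm_torusChar_sub_one p.1 x) _
    have hl0 : 0 ≤ (l.map fun p => (4 * |((∑ j, p.1 j * x j).valMinAbs : ℝ)| / L) ^ p.2).prod :=
      List.prod_nonneg fun a ha => by
        obtain ⟨q, -, rfl⟩ := List.mem_map.1 ha
        positivity
    exact mul_le_mul h1 ih hl0 (by positivity)

/-- **The weight dominates the polynomial decay weight**: with nonnegative coefficients,
`Σ_t c_t (Π (4|ã_v(x)|/L)^{N})² ≤ W(x)`, so `W(x)⁻¹ ≤ (Σ_t c_t (Π (4|ã_v(x)|/L)^{N})²)⁻¹` wherever the latter is positive. [folklore] -/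
theorem prod_chord_pow_le_weight {ι : Type*} (T : Finset ι) (term : ι → List (TorusSite d L × ℕ)) {c : ι → ℝ}
    (hc : ∀ t ∈ T, 0 ≤ c t) (x : TorusSite d L) :
    ∑ t ∈ T, c t * ((term t).map fun p => (4 * |((∑ j, p.1 j * x j).valMinAbs : ℝ)| / L) ^ p.2).prod ^ 2 ≤
      ∑ t ∈ T, c t * ((term t).map fun p => ‖torusChar p.1 x - 1‖ ^ p.2).prod ^ 2 := by
  refine Finset.sum_le_sum fun t ht => mul_le_mul_of_nonneg_left ?_ (hc t ht)
  have hl0 : 0 ≤ ((term t).map fun p => (4 * |((∑ j, p.1 j * x j).valMinAbs : ℝ)| / L) ^ p.2).prod :=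
    List.prod_nonneg fun a ha => by
      obtain ⟨q, -, rfl⟩ := List.mem_map.1 ha
      positivity
  exact pow_le_pow_left₀ hl0 (prod_chord_pow_le x (term t)) 2

end Summit.HubbardSuperconductivity.HubbardSuperconductivity.Theorems.TorusFourierL2

end
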